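import Mathlib.Analysis.Calculus.Deriv.Pow
import Mathlib.Analysis.Calculus.Deriv.Mul
import Mathlib.Analysis.Calculus.Deriv.Add
import Mathlib.Analysis.SpecialFunctions.Trigonometric.Inverse
import Literature.Geometry.Lorentzian.KerrPhotonOrbitHamiltonian
import HarnessLib

/-!
# The null radial Carter potential of Kerr, Θ-admissible constants, and the photon-shell radii

(family `gr`; namespace `Literature.Geometry.Lorentzian.Kerr`; companion of
`KerrPhotonOrbitHamiltonian.lean` and prerequisite of `KerrPhotonShellTurningPoints.lean`.)

For the Kerr family `(M, a)` the radial motion of a null geodesic with constants of motion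
`(E, L, Q)` (Killing energy, axial angular momentum, Carter constant) is governed by the **null
radial Carter potential** `R(r) = (E(r² + a²) − aL)² − Δ(r)(Q + (L − aE)²)`, `Δ = r² − 2Mr + a²`:
`Σ² ṙ² = R(r)` and, at a turning point, `2Σ² r̈ = R′(r)` (Carter 1968; Bardeen–Press–Teukolsky
1972, (2.10); Chandrasekhar 1983, §62). The constants of an actual geodesic are **Θ-admissible**:
the polar potential `Θ(z) = Q + z²(a²E² − L²/(1 − z²))`, `z = cos θ`, is non-negative somewhere
(vortical constants `Q < 0`, `|L| < |aE|` included). This file records, all PROVED: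

* `Kerr.nullRadialPotential`, `Kerr.NullThetaAdmissible` (the massless analogues of
  `Kerr.radialPotential`, `Kerr.polarPotential` of `KerrGeodesicTeukolskyFluxes.lean`), the
  symmetry `(E, L) ↦ (−E, −L)`, the bounds `Q ≥ −a²E²` and (`L² ≥ a²E²`) `Q ≥ 0` forced by
  admissibility, and the triviality of admissible constants with `P = K = 0`
  (`NullThetaAdmissible.trivial_of_P_eq_zero_of_K_eq_zero`);
* `R′` in closed form (`Kerr.hasDerivAt_nullRadialPotential`, `Kerr.deriv_nullRadialPotential`)
  and the factorisation at a root `Δ(c)R′(c) = 2PG`, `P = Ec² − a(L − aE)`,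
  `G = Ec(c² − 3Mc + 2a²) + (c − M)a(L − aE)` (`Kerr.delta_mul_deriv_nullRadialPotential_of_eq_zero`);
* the closed form `Kerr.photonOrbitRadius M x = 4M cos²(arccos(x/M)/3)` at SIGNED spin
  `|x| ≤ M`: the cubic `r(r − 3M)² = 4x²M` (`Kerr.photonOrbit_p_eq_zero_of_abs_le`; the file
  `KerrPhotonOrbitHamiltonian.lean` has it for `0 ≤ x ≤ M`, the retrograde radius
  `r_ph⁻ ∈ [3M, 4M]`), and for `−M < x ≤ 0` the PROGRADE window `M < r_ph⁺ ≤ 3M`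
  (`Kerr.photonOrbitRadius_neg_mem`; Bardeen–Press–Teukolsky 1972, (2.18));
* the sign of Sbierski's cubic `q(c) = c(c − 3M)² − 4Ma²` off the photon shell
  (`Kerr.photonCubic_pos_of_photonOrbitRadius_lt`: `c > r_ph⁻`;
  `Kerr.photonCubic_pos_of_lt_photonOrbitRadius_neg`: `M < c < r_ph⁺`), and
* **the uniform gap between the event horizon and the prograde photon radius**
  `r₊ + M(1 − χ²)/3 ≤ r_ph⁺(M, |a|)` for `|a| ≤ χM`, `0 ≤ χ < 1`
  (`Kerr.rPlus_add_le_photonOrbitRadius_neg`; from `q(r₊) = r₊(r₊ − M)²` and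
  `|q(c) − q(d)| ≤ 3M²|c − d|` on `[M, 3M]`).

Not here: the turning-point dichotomy itself (`KerrPhotonShellTurningPoints.lean`), the polar and
azimuthal equations, anything about timelike geodesics.

## References

* B. Carter, Commun. Math. Phys. 10 (1968) 280–310, §4 (key `Carter1968`).
* J. M. Bardeen, W. H. Press, S. A. Teukolsky, ApJ 178 (1972) 347, (2.10), (2.18)
  (key `BardeenPressTeukolsky1972`).
* J. Sbierski, Anal. PDE 8 (2015), §7A (key `Sbierski2015`: `p(r) = r(r − 3m)² − 4a²m`).
-/

noncomputable section

open Real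

namespace Literature.Geometry.Lorentzian.Kerr

/-! ### The null radial potential and Θ-admissibility -/

/-- The **null radial Carter potential** of Kerr `(M, a)` with constants of motion `(E, L, Q)`:
`R(r) = (E(r² + a²) − aL)² − Δ(r)(Q + (L − aE)²)`, `Δ = r² − 2Mr + a²`; along an affinely
parametrised null geodesic `Σ² ṙ² = R(r)` (the massless case of `Kerr.radialPotential`, which has
the extra `−Δ r²`). Carter 1968, §4; Bardeen–Press–Teukolsky 1972, (2.10).
[cite: BardeenPressTeukolsky1972, (2.10)] -/
def nullRadialPotential (M a E L Q r : ℝ) : ℝ :=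
  (E * (r ^ 2 + a ^ 2) - a * L) ^ 2 - (r ^ 2 - 2 * M * r + a ^ 2) * (Q + (L - a * E) ^ 2)

/-- **Θ-admissibility** of null constants of motion `(E, L, Q)` at spin `a`: the null polar
potential `Θ(z) = Q + z²(a²E² − L²/(1 − z²))`, `z = cos θ`, is non-negative at some `|z| < 1`,
i.e. `(E, L, Q)` are the constants of an actual null geodesic (vortical constants `Q < 0`,
`|L| < |aE|` included). Carter 1968, §4 (the `θ`-equation); cf. `Kerr.polarPotential` (unit
mass). [cite: Carter1968, §4] -/
def NullThetaAdmissible (a E L Q : ℝ) : Prop :=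
  ∃ z : ℝ, z ^ 2 < 1 ∧ 0 ≤ Q + z ^ 2 * (a ^ 2 * E ^ 2 - L ^ 2 / (1 - z ^ 2))

/-- `(E, L) ↦ (−E, −L)` is a symmetry of the null radial potential. [folklore] -/
theorem nullRadialPotential_neg_neg (M a E L Q : ℝ) :
    nullRadialPotential M a (-E) (-L) Q = nullRadialPotential M a E L Q := by
  funext r
  unfold nullRadialPotential
  ring

/-- `(E, L) ↦ (−E, −L)` preserves Θ-admissibility. [folklore] -/
theorem nullThetaAdmissible_neg_neg {a E L Q : ℝ} (h : NullThetaAdmissible a E L Q) :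
    NullThetaAdmissible a (-E) (-L) Q := by
  obtain ⟨z, hz, hΘ⟩ := h
  exact ⟨z, hz, by simpa only [even_two.neg_pow] using hΘ⟩

/-- Θ-admissibility bounds the Carter constant from below: `Q ≥ −a²E²`. [folklore] -/
theorem NullThetaAdmissible.neg_sq_mul_sq_le {a E L Q : ℝ} (h : NullThetaAdmissible a E L Q) :
    -(a ^ 2 * E ^ 2) ≤ Q := by
  obtain ⟨z, hz, hΘ⟩ := h
  have h1z : 0 < 1 - z ^ 2 := by linarith
  have hL : 0 ≤ L ^ 2 / (1 - z ^ 2) := div_nonneg (sq_nonneg L) h1z.le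
  have hz0 : 0 ≤ z ^ 2 := sq_nonneg z
  have hz1 : z ^ 2 ≤ 1 := hz.le
  have h2 : z ^ 2 * (a ^ 2 * E ^ 2 - L ^ 2 / (1 - z ^ 2)) ≤ z ^ 2 * (a ^ 2 * E ^ 2) :=
    mul_le_mul_of_nonneg_left (by linarith) hz0
  have h3 : z ^ 2 * (a ^ 2 * E ^ 2) ≤ 1 * (a ^ 2 * E ^ 2) :=
    mul_le_mul_of_nonneg_right hz1 (by positivity)
  linarith

/-- If `L² ≥ a²E²` (in particular for `E = 0`), Θ-admissibility forces `Q ≥ 0`. [folklore] -/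
theorem NullThetaAdmissible.carter_nonneg {a E L Q : ℝ} (h : NullThetaAdmissible a E L Q)
    (hL : a ^ 2 * E ^ 2 ≤ L ^ 2) : 0 ≤ Q := by
  obtain ⟨z, hz, hΘ⟩ := h
  have h1z : 0 < 1 - z ^ 2 := by linarith
  have hfrac : L ^ 2 ≤ L ^ 2 / (1 - z ^ 2) := by
    rw [le_div_iff₀ h1z]
    nlinarith [sq_nonneg L, sq_nonneg z]
  have h2 : z ^ 2 * (a ^ 2 * E ^ 2 - L ^ 2 / (1 - z ^ 2)) ≤ 0 :=
    mul_nonpos_of_nonneg_of_nonpos (sq_nonneg z) (by linarith)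
  linarith

/-- At a simultaneous zero of `P = E(c² + a²) − aL` and of the Carter quantity
`K = Q + (L − aE)²`, Θ-admissible constants are trivial: from `Θ(z) ≥ 0` and `K = 0` one gets
`(1 − z²)Θ(z) = −(L − (1 − z²)aE)² ≥ 0`, so `L = (1 − z²)aE`, `P = E(c² + z²a²)`, whence `E = 0`
for `c ≠ 0`, then `L = 0`, `Q = 0`. [folklore] -/
theorem NullThetaAdmissible.trivial_of_P_eq_zero_of_K_eq_zero {a E L Q c : ℝ}
    (h : NullThetaAdmissible a E L Q) (hc : c ≠ 0)
    (hP : E * (c ^ 2 + a ^ 2) - a * L = 0) (hK : Q + (L - a * E) ^ 2 = 0) :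
    E = 0 ∧ L = 0 ∧ Q = 0 := by
  obtain ⟨z, hz, hΘ⟩ := h
  have h1z : 0 < 1 - z ^ 2 := by linarith
  -- clear the denominator in `Θ(z) ≥ 0`
  have hΘ' : 0 ≤ (1 - z ^ 2) * Q + z ^ 2 * ((1 - z ^ 2) * (a ^ 2 * E ^ 2) - L ^ 2) := by
    have := mul_nonneg h1z.le hΘ
    have e : (1 - z ^ 2) * (Q + z ^ 2 * (a ^ 2 * E ^ 2 - L ^ 2 / (1 - z ^ 2))) =
        (1 - z ^ 2) * Q + z ^ 2 * ((1 - z ^ 2) * (a ^ 2 * E ^ 2) - L ^ 2) := by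
      field_simp
    linarith [e ▸ this]
  have hQ : Q = -(L - a * E) ^ 2 := by linarith
  have hsq : (L - (1 - z ^ 2) * (a * E)) ^ 2 ≤ 0 := by
    rw [hQ] at hΘ'
    nlinarith [hΘ']
  have hL : L = (1 - z ^ 2) * (a * E) := by
    nlinarith [sq_nonneg (L - (1 - z ^ 2) * (a * E))]
  have hP' : E * (c ^ 2 + z ^ 2 * a ^ 2) = 0 := by
    rw [hL] at hP
    linear_combination hP
  have hpos : 0 < c ^ 2 + z ^ 2 * a ^ 2 := by positivity
  have hE : E = 0 := by
    rcases mul_eq_zero.1 hP' with h | h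
    · exact h
    · exact absurd h hpos.ne'
  refine ⟨hE, ?_, ?_⟩
  · rw [hL, hE]; ring
  · rw [hQ, hL, hE]; ring

/-! ### The derivative of the potential -/

/-- The `r`-derivative of the null radial potential:
`R′(r) = 4Er(E(r² + a²) − aL) − (2r − 2M)(Q + (L − aE)²)`. [folklore] -/
theorem hasDerivAt_nullRadialPotential (M a E L Q r : ℝ) :
    HasDerivAt (nullRadialPotential M a E L Q)
      (4 * E * r * (E * (r ^ 2 + a ^ 2) - a * L) - (2 * r - 2 * M) * (Q + (L - a * E) ^ 2)) r := by
  have h1 : HasDerivAt (fun r : ℝ => E * (r ^ 2 + a ^ 2) - a * L) (E * (2 * r)) r := by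
    have := ((hasDerivAt_pow 2 r).add_const (a ^ 2)).const_mul E
    simpa using this.sub_const (a * L)
  have h2 : HasDerivAt (fun r : ℝ => r ^ 2 - 2 * M * r + a ^ 2) (2 * r - 2 * M) r := by
    have := ((hasDerivAt_pow 2 r).sub ((hasDerivAt_id r).const_mul (2 * M))).add_const (a ^ 2)
    simpa using this
  have h3 := (h1.pow 2).sub (h2.mul_const (Q + (L - a * E) ^ 2))
  have e : nullRadialPotential M a E L Q =
      fun r : ℝ => (E * (r ^ 2 + a ^ 2) - a * L) ^ 2 - (r ^ 2 - 2 * M * r + a ^ 2) *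
        (Q + (L - a * E) ^ 2) := rfl
  rw [e]
  refine h3.congr_deriv ?_
  push_cast
  ring

/-- `R′` in closed form (`deriv` version of `hasDerivAt_nullRadialPotential`). [folklore] -/
theorem deriv_nullRadialPotential (M a E L Q r : ℝ) :
    deriv (nullRadialPotential M a E L Q) r =
      4 * E * r * (E * (r ^ 2 + a ^ 2) - a * L) - (2 * r - 2 * M) * (Q + (L - a * E) ^ 2) :=
  (hasDerivAt_nullRadialPotential M a E L Q r).deriv

/-- **The factorisation at a root.** If `R(c) = 0` then, with `s = L − aE`, `P = Ec² − as` and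
`G = Ec(c² − 3Mc + 2a²) + (c − M)as`: `Δ(c) R′(c) = 2PG`. [folklore] -/
theorem delta_mul_deriv_nullRadialPotential_of_eq_zero {M a E L Q c : ℝ}
    (hroot : nullRadialPotential M a E L Q c = 0) :
    (c ^ 2 - 2 * M * c + a ^ 2) * deriv (nullRadialPotential M a E L Q) c =
      2 * (E * c ^ 2 - a * (L - a * E)) *
        (E * c * (c ^ 2 - 3 * M * c + 2 * a ^ 2) + (c - M) * a * (L - a * E)) := by
  rw [deriv_nullRadialPotential]
  unfold nullRadialPotential at hroot
  linear_combination (2 * c - 2 * M) * hroot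

/-! ### The photon-orbit closed form at signed spin `|x| ≤ M` -/

/-- The photon-orbit cubic `√r (r − 3M) = 2x√M` for the closed form `r = photonOrbitRadius M x`
at every `|x| ≤ M` (the proof of `photonOrbit_cubic` uses only `−1 ≤ x/M ≤ 1`); for `x ≤ 0`
this is the PROGRADE branch of Bardeen–Press–Teukolsky's `r_ph = 2M{1 + cos[⅔ arccos(∓a/M)]}`
at spin `|x|`. [cite: BardeenPressTeukolsky1972, §II] -/
theorem photonOrbit_cubic_of_abs_le {M x : ℝ} (hM : 0 < M) (hx : |x| ≤ M) :
    photonOrbitSqrtRadius M x * (photonOrbitSqrtRadius M x ^ 2 - 3 * M) = 2 * x * √M := by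
  have hs : 0 < √M := sqrt_pos.2 hM
  have hsq : √M ^ 2 = M := sq_sqrt hM.le
  have hxM : -1 ≤ x / M ∧ x / M ≤ 1 := by
    rw [abs_le] at hx
    constructor
    · rw [le_div_iff₀ hM]; linarith
    · rw [div_le_one hM]; linarith
  have h3 : cos (3 * photonOrbitAngle M x) = x / M := by
    have : 3 * photonOrbitAngle M x = arccos (x / M) := by unfold photonOrbitAngle; ring
    rw [this, cos_arccos hxM.1 hxM.2]
  rw [cos_three_mul] at h3
  set c := cos (photonOrbitAngle M x) with hc
  unfold photonOrbitSqrtRadius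
  rw [← hc]
  have h5 : M * (4 * c ^ 3 - 3 * c) = x := by
    rw [h3]; field_simp
  have : 2 * √M * c * ((2 * √M * c) ^ 2 - 3 * M) = 2 * √M * (M * (4 * c ^ 3 - 3 * c)) := by
    rw [mul_pow, mul_pow, hsq]; ring
  rw [this, h5]
  ring

/-- Sbierski's `p(r) = r(r − 3M)² − 4x²M = 0` at `r = photonOrbitRadius M x`, every `|x| ≤ M`.
[cite: Sbierski2015, §7A (arXiv §3.2.1)] -/
theorem photonOrbit_p_eq_zero_of_abs_le {M x : ℝ} (hM : 0 < M) (hx : |x| ≤ M) :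
    photonOrbitRadius M x * (photonOrbitRadius M x - 3 * M) ^ 2 - 4 * x ^ 2 * M = 0 := by
  have h := photonOrbit_cubic_of_abs_le hM hx
  have hsq : √M ^ 2 = M := sq_sqrt hM.le
  unfold photonOrbitRadius
  have : photonOrbitSqrtRadius M x ^ 2 * (photonOrbitSqrtRadius M x ^ 2 - 3 * M) ^ 2 =
      (photonOrbitSqrtRadius M x * (photonOrbitSqrtRadius M x ^ 2 - 3 * M)) ^ 2 := by ring
  rw [this, h, mul_pow, mul_pow, hsq]
  ring

/-- **The prograde photon radius lies in `(M, 3M]`**: for `−M < x ≤ 0`,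
`M < photonOrbitRadius M x ≤ 3M` (`arccos (x/M) ∈ [π/2, π)`, so the angle is in `[π/6, π/3)` and
`r = 4M cos²` of it). Bardeen–Press–Teukolsky 1972, §II. [cite: BardeenPressTeukolsky1972, §II] -/
theorem photonOrbitRadius_neg_mem {M x : ℝ} (hM : 0 < M) (hx : -M < x) (hx0 : x ≤ 0) :
    M < photonOrbitRadius M x ∧ photonOrbitRadius M x ≤ 3 * M := by
  rw [photonOrbitRadius_eq M x hM.le]
  have hθ1 : π / 6 ≤ photonOrbitAngle M x := by
    unfold photonOrbitAngle
    have : π / 2 ≤ arccos (x / M) := by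
      rw [← not_lt, arccos_lt_pi_div_two, not_lt]
      exact div_nonpos_of_nonpos_of_nonneg hx0 hM.le
    linarith
  have hθ2 : photonOrbitAngle M x < π / 3 := by
    unfold photonOrbitAngle
    have : arccos (x / M) < π := by
      rw [arccos_lt_pi, lt_div_iff₀ hM]; linarith
    linarith
  have hc1 : cos (photonOrbitAngle M x) ≤ √3 / 2 := by
    rw [← cos_pi_div_six]
    exact cos_le_cos_of_nonneg_of_le_pi (by linarith [pi_pos]) (by linarith [pi_pos]) hθ1
  have hc2 : 1 / 2 < cos (photonOrbitAngle M x) := by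
    rw [← cos_pi_div_three]
    exact cos_lt_cos_of_nonneg_of_le_pi (by linarith [pi_pos]) (by linarith [pi_pos]) hθ2
  have h3 : (√3 / 2) ^ 2 = 3 / 4 := by
    rw [div_pow, sq_sqrt (by norm_num)]; norm_num
  have hsq1 : cos (photonOrbitAngle M x) ^ 2 ≤ 3 / 4 := by
    rw [← h3]
    exact pow_le_pow_left₀ (by linarith) hc1 2
  have hsq2 : 1 / 4 < cos (photonOrbitAngle M x) ^ 2 := by nlinarith
  constructor <;> nlinarith

/-! ### Sbierski's cubic `q(c) = c(c − 3M)² − 4Ma²` off the shell -/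

/-- Beyond the retrograde photon radius the cubic is positive: `c > r_ph⁻(M, |a|) ⇒
c(c − 3M)² − 4Ma² > 0` (`q` is strictly increasing on `[3M, ∞) ∋ r_ph⁻` and vanishes at
`r_ph⁻`). [folklore] -/
theorem photonCubic_pos_of_photonOrbitRadius_lt {M a c : ℝ} (hM : 0 < M) (ha : |a| ≤ M)
    (hc : photonOrbitRadius M |a| < c) : 0 < c * (c - 3 * M) ^ 2 - 4 * M * a ^ 2 := by
  have hd := (photonOrbitRadius_mem hM (abs_nonneg a)).1
  have hq := photonOrbit_p_eq_zero hM (abs_nonneg a) ha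
  rw [sq_abs] at hq
  set d := photonOrbitRadius M |a|
  have h1 : (d - 3 * M) ^ 2 < (c - 3 * M) ^ 2 := by nlinarith
  have h2 : 0 ≤ (d - 3 * M) ^ 2 := sq_nonneg _
  nlinarith

/-- Strictly between `M` and the prograde photon radius the cubic is positive:
`M < c < r_ph⁺(M, |a|) ⇒ c(c − 3M)² − 4Ma² > 0` (`q` is strictly decreasing on `[M, 3M] ∋ r_ph⁺`,
through `q(c) − q(d) = (c − d)(c² + cd + d² − 6M(c + d) + 9M²)`). [folklore] -/
theorem photonCubic_pos_of_lt_photonOrbitRadius_neg {M a c : ℝ} (hM : 0 < M) (ha : |a| < M)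
    (hMc : M < c) (hc : c < photonOrbitRadius M (-|a|)) :
    0 < c * (c - 3 * M) ^ 2 - 4 * M * a ^ 2 := by
  obtain ⟨hd1, hd3⟩ := photonOrbitRadius_neg_mem (x := -|a|) hM (by linarith [abs_nonneg a])
    (neg_nonpos.2 (abs_nonneg a))
  have hq := photonOrbit_p_eq_zero_of_abs_le hM (x := -|a|) (by rw [abs_neg, abs_abs]; exact ha.le)
  rw [neg_sq, sq_abs] at hq
  set d := photonOrbitRadius M (-|a|)
  -- `q(c) − q(d) = (c − d)·F`, `F = u² + uv + v² − 3M² < 0` for `u = c − 2M, v = d − 2M ∈ (−M, M]`, `u < v`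
  have hF : (c - 2 * M) ^ 2 + (c - 2 * M) * (d - 2 * M) + (d - 2 * M) ^ 2 < 3 * M ^ 2 := by
    nlinarith
  have e : c * (c - 3 * M) ^ 2 - 4 * M * a ^ 2 =
      (d * (d - 3 * M) ^ 2 - 4 * a ^ 2 * M) + (c - d) *
        ((c - 2 * M) ^ 2 + (c - 2 * M) * (d - 2 * M) + (d - 2 * M) ^ 2 - 3 * M ^ 2) := by ring
  rw [e, hq, zero_add]
  exact mul_pos_of_neg_of_neg (by linarith) (by linarith)

/-- **The uniform gap between the horizon and the prograde photon radius**: for `0 < M`,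
`0 ≤ χ < 1` and `|a| ≤ χM`, `r₊ + M(1 − χ²)/3 ≤ r_ph⁺(M, |a|)` — from `q(r₊) = r₊(r₊ − M)² ≥
M³(1 − χ²)` and `|q(c) − q(d)| ≤ 3M²|c − d|` on `[M, 3M]`. Bardeen–Press–Teukolsky 1972, §II
(`r_ph⁺ > r₊` off extremality); the constant is ours. [folklore] -/
theorem rPlus_add_le_photonOrbitRadius_neg {M a χ : ℝ} (hM : 0 < M) (hχ0 : 0 ≤ χ) (hχ : χ < 1)
    (ha : |a| ≤ χ * M) : rPlus M a + M * (1 - χ ^ 2) / 3 ≤ photonOrbitRadius M (-|a|) := by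
  have haM : |a| < M := by nlinarith
  have ha2M : a ^ 2 < M ^ 2 := by
    have h1 : |a| ^ 2 < M ^ 2 := pow_lt_pow_left₀ haM (abs_nonneg a) two_ne_zero
    rwa [sq_abs] at h1
  obtain ⟨hd1, hd3⟩ := photonOrbitRadius_neg_mem (x := -|a|) hM (by linarith [abs_nonneg a])
    (neg_nonpos.2 (abs_nonneg a))
  have hq := photonOrbit_p_eq_zero_of_abs_le hM (x := -|a|) (by rw [abs_neg, abs_abs]; exact haM.le)
  rw [neg_sq, sq_abs] at hq
  set d := photonOrbitRadius M (-|a|)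
  -- facts about `r₊ = M + S`, `S = √(M² − a²)`
  have ha2 : a ^ 2 ≤ χ ^ 2 * M ^ 2 := by
    have h1 : |a| ^ 2 ≤ (χ * M) ^ 2 := pow_le_pow_left₀ (abs_nonneg a) ha 2
    rw [sq_abs] at h1
    linarith [h1, mul_pow χ M 2]
  set S := √(M ^ 2 - a ^ 2) with hS
  have hr : rPlus M a = M + S := rfl
  have hS0 : 0 ≤ S := sqrt_nonneg _
  have hS2 : S ^ 2 = M ^ 2 - a ^ 2 := by
    rw [hS, sq_sqrt]; linarith
  have hSM : S ≤ M := by nlinarith [sq_nonneg a, sq_nonneg S]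
  have hS2' : M ^ 2 * (1 - χ ^ 2) ≤ S ^ 2 := by nlinarith
  rw [hr]
  -- `q(r₊) − q(d) = (r₊ − d)·F` and `q(r₊) = r₊ S²`
  have e : (M + S) * ((M + S) - 3 * M) ^ 2 - 4 * M * a ^ 2 =
      (d * (d - 3 * M) ^ 2 - 4 * a ^ 2 * M) + ((M + S) - d) *
        (((M + S) - 2 * M) ^ 2 + ((M + S) - 2 * M) * (d - 2 * M) + (d - 2 * M) ^ 2
          - 3 * M ^ 2) := by ring
  have e2 : (M + S) * ((M + S) - 3 * M) ^ 2 - 4 * M * a ^ 2 = (M + S) * S ^ 2 := by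
    have : a ^ 2 = M ^ 2 - S ^ 2 := by linarith
    rw [this]; ring
  set F := ((M + S) - 2 * M) ^ 2 + ((M + S) - 2 * M) * (d - 2 * M) + (d - 2 * M) ^ 2
    - 3 * M ^ 2 with hF
  have key : (d - (M + S)) * (-F) = (M + S) * S ^ 2 := by
    rw [hq, zero_add] at e
    linarith [e, e2]
  have hFle : -F ≤ 3 * M ^ 2 := by
    rw [hF]
    nlinarith [sq_nonneg ((M + S) - 2 * M + (d - 2 * M) / 2), sq_nonneg (d - 2 * M)]
  have hFnn : 0 ≤ -F := by
    rw [hF]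
    have hu0 : (M + S) - 2 * M ≤ 0 := by linarith
    have hu1 : 0 ≤ (M + S) - 2 * M + M := by linarith
    have hv1 : 0 < d - 2 * M + M := by linarith
    have hv2 : d - 2 * M ≤ M := by linarith
    nlinarith [mul_nonneg (neg_nonneg.2 hu0) hv1.le, mul_nonneg hu1 (sub_nonneg.2 hv2)]
  have hq0 : M ^ 3 * (1 - χ ^ 2) ≤ (M + S) * S ^ 2 := by
    have hχ2 : 0 ≤ 1 - χ ^ 2 := by nlinarith
    have : M * (M ^ 2 * (1 - χ ^ 2)) ≤ (M + S) * S ^ 2 :=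
      mul_le_mul (by linarith) hS2' (mul_nonneg (sq_nonneg M) hχ2) (by linarith)
    linarith
  have hpos : 0 < (M + S) * S ^ 2 := by
    have : 0 < M ^ 3 * (1 - χ ^ 2) := by
      have : 0 < 1 - χ ^ 2 := by nlinarith
      positivity
    linarith
  have hgap : 0 < d - (M + S) := by
    by_contra h
    have : (d - (M + S)) * (-F) ≤ 0 := mul_nonpos_of_nonpos_of_nonneg (not_lt.1 h) hFnn
    linarith
  have h3 : (M + S) * S ^ 2 ≤ (d - (M + S)) * (3 * M ^ 2) := by
    rw [← key]
    exact mul_le_mul_of_nonneg_left hFle hgap.le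
  nlinarith

end Literature.Geometry.Lorentzian.Kerr

end
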